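import Summits.BirchSwinnertonDyer.Rank1Residual.X11a.SelmerCompanionTateLineResidueWitness
import Literature.NumberTheory.EllipticCurves.ReductionHomomorphismSurjectiveProofs
import Literature.RingTheory.DiscreteValuationRing.AdicCompletionHensel
import HarnessLib

/-!
# Route (3e) SELMER COMPANION, XLIV: Hensel — shape G's Kummer point from a point of `Ã(k_v)`
# (class X11a = N7; cell `b2b-bsdres`, unit `b2b-bsdres-x11a`, gen 33)

HONEST FRAMING (run/shared/lean/b2b/bsd-rank1-residual/, verbatim in every file): the goal of the
cell is to DELETE the COMBINATION-SHAPED residual classes of the Birch–Swinnerton-Dyer formula for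
ALL analytic-rank `≤ 1` elliptic curves over `ℚ` — "full BSD formula for every rank `≤ 1` curve in
class `C`" assembled STRICTLY from published theorems — so that the rank-`≤ 1` remainder becomes
exactly the CONSTRUCTION-SHAPED classes, which are TYPED (missing-input `Prop`s), NOT attempted.
This is not "finishing BSD". CLASS-OWNERS.md: research routes; NO CLAIM BEYOND STATED CLASSES.
THEOREMS ONLY; nothing booked; no label moves.

## What this file proves

Completion of files XLII/XLIII (residue-field reading of the Tate-line certificates of shape G /
shape F modes lt, nslt). File XLIII's `hpt_of_tateLine_residue_witness` still takes a
`Γ_{ℚ_v}`-fixed point `t ∈ A(K̄_v)` lifting the census's Kummer point `P̃ ∈ Ã(𝔽_ℓ)`. Here: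

* `exists_fixed_localPoint_of_residuePoint` — **Hensel**: for the minimal model of `A` with unit
  discriminant at `w` and the structure map `ι : ℤ_v → 𝒪_w`, every affine point `(α, β)` of the
  reduction over the residue field `k_v` of `ℤ_v` is `red₀ t` (read through `ῑ : k_v → 𝒪_w/𝔪_w`)
  for some `Γ_{ℚ_v}`-FIXED `t ∈ A(K̄_v)` — Hensel's lemma over the complete discrete valuation
  ring `ℤ_v` (tree `exists_equation_residue_eq`, Silverman VII.2.1; `ℤ_v` is henselian by the
  tree instance `adicCompletionIntegers.isAdicComplete`), the lifted point having coordinates in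
  `ℚ_v`;
* `hpt_of_tateLine_residuePoint_witness` — **`hpt` from a point of `Ã(k_v)`**: the hypothesis
  `hpt` of files XXXIV/XXXV/XXXVIII from an affine point `(α, β) ∈ Ã(k_v)` all of whose `p`-th
  roots `c̃` over `𝒪_w/𝔪_w` have `Frob(c̃) ≠ c̃` and `Frob(c̃) − c̃ ∈ red₀(Λ)` (the census column
  `kummerpoint: P̃, δ⁻¹(P̃) ∈ Λ̃ ∖ {O}`).

So the only datum of the Tate-line rows not read at residue level in the kernel is
`Λ̃ = red₀(Λ)` itself (the row's equivariant `θ`, explicit in the two engines). Binders: none new.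
Not a class theorem; nothing booked.

References: [SilvermanAEC2009] VII.2.1; [NeukirchANT1999] II §4; files XLII, XLIII;
HOME/b2b-bsdres-x11a/REPORT-g33.md.
-/

set_option autoImplicit false

noncomputable section

open scoped Classical NNReal

open WeierstrassCurve Literature.NumberTheory.EllipticCurves
  Literature.NumberTheory.GaloisRepresentations Field NumberField IsDedekindDomain
  IsDedekindDomain.HeightOneSpectrum Literature.NumberTheory.EllipticCurves.FormalGroupChart
  Literature.NumberTheory.EllipticCurves.Rank1Residual
  Literature.NumberTheory.EllipticCurves.Rank1Residual.Typed

namespace Summit.BirchSwinnertonDyer.Rank1Residual.X11a.SelmerCompanion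

variable (A : WeierstrassCurve ℚ) [A.IsGloballyMinimal] (p : ℕ) [hp : Fact p.Prime]
  {v : HeightOneSpectrum (𝓞 ℚ)}
  {w : Valuation (AlgebraicClosure (v.adicCompletion ℚ)) ℝ≥0}
  (hw : ∀ x, (w x : ℝ) = spectralNorm (v.adicCompletion ℚ) (AlgebraicClosure (v.adicCompletion ℚ)) x)
  (hΔu : IsUnit ((integralModelInt A).map (algebraMap ℤ ↥w.valuationSubring)).Δ)
  (red₀ : localPoints A (v.adicCompletion ℚ) →+
    (((integralModelInt A).map (algebraMap ℤ ↥w.valuationSubring)).map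
      (IsLocalRing.residue ↥w.valuationSubring)).toAffine.Point)
  (hred₀ : ∀ P : localPoints A (v.adicCompletion ℚ), red₀ P =
    ((integralModelInt A).map (algebraMap ℤ ↥w.valuationSubring)).reducePoint
      (Affine.Point.congrEquiv (localIntModel_baseChange A w.valuationSubring).symm P))

/-! ## Hensel: points of `Ã(k_v)` lift to `Γ_{ℚ_v}`-fixed points of `A(K̄_v)` -/

include hΔu hred₀ in
/-- **A point of `Ã(k_v)` lifts to a `Γ_{ℚ_v}`-fixed point of `A(K̄_v)` with that reduction.**
`A` globally minimal with unit discriminant at `w` (`hΔu`); `ι : ℤ_v → 𝒪_w` the structure map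
(`hι`; `exists_ringHom_adicCompletionIntegers_integer`), a local homomorphism, inducing
`k_v → 𝒪_w/𝔪_w` on residue fields. For every affine point `(α, β)` of the reduction of the
minimal model over the residue field `k_v` of `ℤ_v` there is `t ∈ A(K̄_v)` fixed by `Γ_{ℚ_v}` with
`red₀ t = (ῑ α, ῑ β)`. PROOF: Hensel's lemma over the complete discrete valuation ring `ℤ_v`
(`exists_equation_residue_eq`, Silverman VII.2.1; `ℤ_v` henselian:
`adicCompletionIntegers.isAdicComplete`) gives `(a, b) ∈ A_ℤ(ℤ_v)` reducing to `(α, β)`; its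
image in `A(K̄_v)` has coordinates in `ℚ_v` (fixed by `Γ_{ℚ_v}`) and `w`-integral, with residues
`ῑ α, ῑ β` (`IsLocalRing.ResidueField.map_residue`). [cite: SilvermanAEC2009, Prop. VII.2.1]
[cite: NeukirchANT1999, Ch. II §4 (4.6)] -/
theorem exists_fixed_localPoint_of_residuePoint [A.IsElliptic]
    (ι : v.adicCompletionIntegers ℚ →+* ↥w.valuationSubring) [IsLocalHom ι]
    (hι : ∀ a, ((ι a : ↥w.valuationSubring) : AlgebraicClosure (v.adicCompletion ℚ)) =
      algebraMap (v.adicCompletion ℚ) (AlgebraicClosure (v.adicCompletion ℚ))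
        (a : v.adicCompletion ℚ))
    (α β : IsLocalRing.ResidueField (v.adicCompletionIntegers ℚ))
    (hαβ : ((integralModelInt A).map (algebraMap ℤ
      (IsLocalRing.ResidueField (v.adicCompletionIntegers ℚ)))).toAffine.Nonsingular α β) :
    ∃ (t : localPoints A (v.adicCompletion ℚ))
      (hns : (((integralModelInt A).map (algebraMap ℤ ↥w.valuationSubring)).map
        (IsLocalRing.residue ↥w.valuationSubring)).toAffine.Nonsingular
        (IsLocalRing.ResidueField.map ι α) (IsLocalRing.ResidueField.map ι β)),
      (∀ σ : absoluteGaloisGroup (v.adicCompletion ℚ), σ • t = t) ∧ red₀ t = .some _ _ hns := by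
  have hMK := localIntModel_baseChange A w.valuationSubring
  set Mv := (integralModelInt A).map (algebraMap ℤ (v.adicCompletionIntegers ℚ)) with hMv
  -- `(α, β)` is a nonsingular point of `Mv mod 𝔪_v`; Hensel lift `(a, b)`
  have hred_v : Mv.map (IsLocalRing.residue (v.adicCompletionIntegers ℚ)) =
      (integralModelInt A).map (algebraMap ℤ
        (IsLocalRing.ResidueField (v.adicCompletionIntegers ℚ))) := by
    rw [hMv, WeierstrassCurve.map_map]
    exact congrArg _ (RingHom.ext_int _ _)
  have hαβ' : (Mv.map (IsLocalRing.residue (v.adicCompletionIntegers ℚ))).toAffine.Nonsingular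
      α β := by
    rw [hred_v]; exact hαβ
  obtain ⟨a, b, hab, ha, hb⟩ := Mv.exists_equation_residue_eq hαβ'
  -- the `𝒪_w`-point `(ι a, ι b)` of the minimal model over `𝒪_w`
  have hMw : Mv.map ι = (integralModelInt A).map (algebraMap ℤ ↥w.valuationSubring) := by
    rw [hMv, WeierstrassCurve.map_map]
    exact congrArg _ (RingHom.ext_int _ _)
  have hab' : ((integralModelInt A).map (algebraMap ℤ ↥w.valuationSubring)).toAffine.Equation
      (ι a) (ι b) := by
    rw [← hMw]; exact hab.map ι
  set x : AlgebraicClosure (v.adicCompletion ℚ) := ((ι a : ↥w.valuationSubring) :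
    AlgebraicClosure (v.adicCompletion ℚ)) with hxdef
  set y : AlgebraicClosure (v.adicCompletion ℚ) := ((ι b : ↥w.valuationSubring) :
    AlgebraicClosure (v.adicCompletion ℚ)) with hydef
  have hxyA : (A.baseChange (AlgebraicClosure (v.adicCompletion ℚ))).toAffine.Equation x y := by
    rw [← hMK]
    exact hab'.map (algebraMap ↥w.valuationSubring (AlgebraicClosure (v.adicCompletion ℚ)))
  have hxy : (A.baseChange (AlgebraicClosure (v.adicCompletion ℚ))).toAffine.Nonsingular x y :=
    (Affine.equation_iff_nonsingular).mp hxyA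
  have hx1 : w x ≤ 1 := (w.mem_valuationSubring_iff _).mp (ι a).2
  obtain ⟨hy1, hns, e⟩ := reducePoint_congrEquiv_some_of_val_le_one hΔu hMK x y hxy hx1
  have hra : IsLocalRing.residue ↥w.valuationSubring ⟨x, hx1⟩ = IsLocalRing.ResidueField.map ι α := by
    rw [show (⟨x, hx1⟩ : ↥w.valuationSubring) = ι a from Subtype.ext rfl, ← ha,
      IsLocalRing.ResidueField.map_residue]
  have hrb : IsLocalRing.residue ↥w.valuationSubring ⟨y, hy1⟩ = IsLocalRing.ResidueField.map ι β := by
    rw [show (⟨y, hy1⟩ : ↥w.valuationSubring) = ι b from Subtype.ext rfl, ← hb,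
      IsLocalRing.ResidueField.map_residue]
  have hns' : (((integralModelInt A).map (algebraMap ℤ ↥w.valuationSubring)).map
      (IsLocalRing.residue ↥w.valuationSubring)).toAffine.Nonsingular
      (IsLocalRing.ResidueField.map ι α) (IsLocalRing.ResidueField.map ι β) := by
    rw [← hra, ← hrb]; exact hns
  refine ⟨Affine.Point.some x y hxy, hns', fun σ ↦ ?_, ?_⟩
  · -- coordinates in `ℚ_v`: fixed by `Γ_{ℚ_v}`
    obtain ⟨h₂, hσP⟩ : ∃ h₂, σ • (show localPoints A (v.adicCompletion ℚ) from
        Affine.Point.some x y hxy) = Affine.Point.some (σ • x) (σ • y) h₂ :=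
      ⟨_, by rw [localPoints.smul_def, Affine.Point.map_some]; rfl⟩
    rw [hσP]
    have hσx : σ • x = x := by rw [hxdef, hι]; exact smul_algebraMap σ _
    have hσy : σ • y = y := by rw [hydef, hι]; exact smul_algebraMap σ _
    simp only [hσx, hσy]
  · rw [hred₀, e]
    simp only [hra, hrb]

/-! ## The Kummer point of shape G from a point of `Ã(k_v)` (finite input) -/

include hw hΔu hred₀ in
/-- **Shape G's `hpt` from a point of `Ã(k_v)` and its residue witness (finite input form).**
As `hpt_of_tateLine_residue_witness`, with the `Γ_{ℚ_v}`-fixed point REPLACED by an affine point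
`(α, β)` of the reduction of the minimal model over the residue field `k_v` of `ℤ_v` (the
census's `kummerpoint P̃ ∈ Ã(𝔽_ℓ)`), read in `Ã(𝒪_w/𝔪_w)` through the structure map
`ι : ℤ_v → 𝒪_w` (`hι`): if every affine `c̃ = (a, b)` over `𝒪_w/𝔪_w` with `p·c̃ = (ῑ α, ῑ β)` has
`(a^q, b^q) ≠ (a, b)` and `(a^q, b^q) − (a, b) = red₀ λ(ζ)` for some `ζ ∈ μ_p` (`hwit`), then
`hpt` holds (Hensel lift `exists_fixed_localPoint_of_residuePoint` + the previous theorem). The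
remaining non-finite datum is `Λ̃ = red₀(Λ)` (the row's `θ`, explicit in the engines).
[cite: SilvermanAEC2009, Prop. VII.2.1, Prop. VII.3.1] [cite: SerreLocalFields1979, Ch. IV §4 Prop. 16] -/
theorem hpt_of_tateLine_residuePoint_witness [A.IsElliptic]
    [hV : (A.baseChange (AlgebraicClosure (v.adicCompletion ℚ))).IsIntegral w.integer]
    (hgood : A.HasGoodReductionAt v) (hpv : (p : 𝓞 ℚ) ∉ v.asIdeal)
    (ι : v.adicCompletionIntegers ℚ →+* ↥w.valuationSubring) [IsLocalHom ι]
    (hι : ∀ a, ((ι a : ↥w.valuationSubring) : AlgebraicClosure (v.adicCompletion ℚ)) =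
      algebraMap (v.adicCompletion ℚ) (AlgebraicClosure (v.adicCompletion ℚ))
        (a : v.adicCompletion ℚ))
    (W : WeierstrassCurve ℚ) [W.IsElliptic] (hn : (p : ℤ) ≠ 0)
    (θ : geomTorsion W (p : ℤ) ≃+ geomTorsion A (p : ℤ))
    (hθ : ∀ (σ : absoluteGaloisGroup ℚ) (P : geomTorsion W (p : ℤ)), θ (σ • P) = σ • θ P)
    (Φ' : Additive (AlgebraicClosure (v.adicCompletion ℚ))ˣ →+ localPoints W (v.adicCompletion ℚ))
    (hequiv' : ∀ (σ : absoluteGaloisGroup (v.adicCompletion ℚ))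
        (u : (AlgebraicClosure (v.adicCompletion ℚ))ˣ),
      σ • Φ' (Additive.ofMul u) = Φ' (Additive.ofMul (Units.map
        (absoluteGaloisGroup.toAlgEquiv _ σ : AlgebraicClosure (v.adicCompletion ℚ) →*
          AlgebraicClosure (v.adicCompletion ℚ)) u)))
    (hμ : ∀ (σ : absoluteGaloisGroup (v.adicCompletion ℚ))
        (ζ : (AlgebraicClosure (v.adicCompletion ℚ))ˣ), ζ ^ p = 1 →
      Units.map (absoluteGaloisGroup.toAlgEquiv _ σ : AlgebraicClosure (v.adicCompletion ℚ) →*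
        AlgebraicClosure (v.adicCompletion ℚ)) ζ = ζ)
    (α β : IsLocalRing.ResidueField (v.adicCompletionIntegers ℚ))
    (hαβ : ((integralModelInt A).map (algebraMap ℤ
      (IsLocalRing.ResidueField (v.adicCompletionIntegers ℚ)))).toAffine.Nonsingular α β)
    (hwit : ∀ (a b : IsLocalRing.ResidueField ↥w.valuationSubring)
        (hab : (((integralModelInt A).map (algebraMap ℤ ↥w.valuationSubring)).map
          (IsLocalRing.residue ↥w.valuationSubring)).toAffine.Nonsingular a b)
        (habq : (((integralModelInt A).map (algebraMap ℤ ↥w.valuationSubring)).map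
          (IsLocalRing.residue ↥w.valuationSubring)).toAffine.Nonsingular
          (a ^ Nat.card (IsLocalRing.ResidueField (v.adicCompletionIntegers ℚ)))
          (b ^ Nat.card (IsLocalRing.ResidueField (v.adicCompletionIntegers ℚ))))
        (hns : (((integralModelInt A).map (algebraMap ℤ ↥w.valuationSubring)).map
          (IsLocalRing.residue ↥w.valuationSubring)).toAffine.Nonsingular
          (IsLocalRing.ResidueField.map ι α) (IsLocalRing.ResidueField.map ι β)),
      (p : ℤ) • (Affine.Point.some a b hab) = Affine.Point.some _ _ hns →
      Affine.Point.some _ _ habq ≠ Affine.Point.some a b hab ∧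
      ∃ (ζ : (AlgebraicClosure (v.adicCompletion ℚ))ˣ) (_ : ζ ^ p = 1)
        (hζ : Φ' (Additive.ofMul ζ) ∈
            AddSubgroup.torsionBy (localPoints W (v.adicCompletion ℚ)) (p : ℤ)),
          (Affine.Point.some _ _ habq) - (Affine.Point.some a b hab) =
            red₀ (pointsMap A (v.adicCompletion ℚ)
              ((θ ((W.torsionPointsEquiv (p : ℤ) (E := v.adicCompletion ℚ) hn).symm
                ⟨Φ' (Additive.ofMul ζ), hζ⟩) : geomTorsion A (p : ℤ)) : geomPoints A))) :
    ∃ h : localPoints A (v.adicCompletion ℚ),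
      (∀ σ : absoluteGaloisGroup (v.adicCompletion ℚ),
        ∃ (ζ : (AlgebraicClosure (v.adicCompletion ℚ))ˣ) (_ : ζ ^ p = 1)
          (hζ : Φ' (Additive.ofMul ζ) ∈
            AddSubgroup.torsionBy (localPoints W (v.adicCompletion ℚ)) (p : ℤ)),
          σ • h - h = pointsMap A (v.adicCompletion ℚ)
            ((θ ((W.torsionPointsEquiv (p : ℤ) (E := v.adicCompletion ℚ) hn).symm
              ⟨Φ' (Additive.ofMul ζ), hζ⟩) : geomTorsion A (p : ℤ)) : geomPoints A)) ∧
      ∃ σ₁ : absoluteGaloisGroup (v.adicCompletion ℚ), σ₁ • h ≠ h := by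
  obtain ⟨t, hns, htfix, hred⟩ :=
    exists_fixed_localPoint_of_residuePoint A hΔu red₀ hred₀ ι hι α β hαβ
  refine hpt_of_tateLine_residue_witness A p hw hΔu red₀ hred₀ hgood hpv W hn θ hθ Φ' hequiv' hμ
    t htfix (by rw [hred]; exact Affine.Point.some_ne_zero _) ?_
  intro a b hab habq hpab
  rw [hred] at hpab
  exact hwit a b hab habq hns hpab

end Summit.BirchSwinnertonDyer.Rank1Residual.X11a.SelmerCompanion

end
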